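import Literature.AlgebraicTopology.SingularHomology.BarycentricSubdivision
import HarnessLib

/-!
# Universal shuffle chains: the Eilenberg–Zilber / Eilenberg–Mac Lane shuffle product on lattice tuples

Topic `Literature/AlgebraicTopology/SingularHomology`. The combinatorial heart of the
**Eilenberg–Zilber theorem** and of the **cross / cup product comparison** (Eilenberg–Mac Lane 1953,
§5 "the shuffle map"; Hatcher, *Algebraic Topology* (2002), §3.B, pp. 277–278: the simplicial
cross product `Δᵖ × Δᵠ = ⋃_shuffles Δᵖ⁺ᵠ`; Bredon, *Topology and Geometry* (1993), VI §1),
carried out on the tree's *tuple chains* (`Literature.AlgebraicTopology.SingularHomology.TupleChain`,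
the free `ℤ`-module on ordered vertex tuples, with boundary `bd`, cone `cone` and push-forward `push`
of `…SingularHomology.BarycentricSubdivision`) over the vertex type of LATTICE POINTS `ℕ × ℕ`.

A `(p,q)`-shuffle is a monotone lattice path from `(0,0)` to `(p,q)`; its `p + q + 1` vertices span
one of the `(p+q)!/(p! q!)` simplices of the standard triangulation of the prism `Δᵖ × Δᵠ`. We define
the **universal shuffle chain** `shuffle n p ∈ TupleChain (ℕ × ℕ) n` (`q = n - p`; zero when
`p > n`) — the signed sum of these paths — by the first-vertex CONE RECURSION
"a path starts with a step right or a step up":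

`shuffle (n+1) (p+1) = (0,0) · R₀(shuffle n p) + (-1)ᵖ⁺¹ (0,0) · U₀(shuffle n (p+1))`,
`shuffle (n+1) 0 = (0,0) · U₀(shuffle n 0)`, `shuffle 0 0 = [(0,0)]`,

where `R₀`, `U₀` translate a path by one unit to the right / upwards (the sign `(-1)ᵖ⁺¹` is the sign
of the shuffle permutation: an initial up-step precedes all `p + 1` right-steps), and prove the
**Eilenberg–Zilber boundary formula** (`bd_shuffle_succ`, `bd_shuffle_zero`)

`∂ shuffle (n+1) (p+1) = ∑_{i ≤ p+1} (-1)ⁱ Rᵢ(shuffle n p) + (-1)ᵖ⁺¹ ∑_{j ≤ n-p} (-1)ʲ Uⱼ(shuffle n (p+1))`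

(`Rᵢ = faceR i`, `Uⱼ = faceU j` the lattice coface maps `δᵢ × 1`, `1 × δⱼ`), i.e. after realization
`∂(σ × τ) = ∂σ × τ + (-1)^{deg σ} σ × ∂τ` for the shuffle product of singular simplices (the
realization against singular simplices and the product of spaces is the sequel file). The proof is
the algebraic induction behind the method of acyclic models made explicit by the cone: only the cone
identity `∂(b · x) = x - b · ∂x` (`TupleChain.bd_cone_succ`) and the cosimplicial identities of the
coface maps `skip i : ℕ → ℕ` enter.

Then the **Alexander–Whitney ∘ Eilenberg–Zilber diagonal** `theta m = ∑_{p+q=m} emb p (shuffle m p)`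
(universal form of `σ ↦ ∑_{p+q=m} (front_p σ) × (back_q σ)`, the shuffle product of the
Alexander–Whitney diagonal) with `bd_theta : ∂ θ_{m+1} = ∑ᵢ (-1)ⁱ (δᵢ × δᵢ) θ_m` (realized:
`∂Θσ = Θ∂σ`), the diagonal tuple `diag m` with `bd_diag`, and the **universal Eilenberg–Zilber
homotopy chains** `homotopyChain m` between `diag` and `theta` with
`bd_homotopyChain : ∂ D_{m+1} + ∑ᵢ (-1)ⁱ (δᵢ × δᵢ) D_m = diag_{m+1} - θ_{m+1}` (realized:
`∂D + D∂ = Δ_* - Θ`) — the method of acyclic models made constructive: the cone with apex `(0,0)`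
contracts the tuple complex, and the double face sum vanishes (`dsum_dsum`, the cosimplicial
identities). These are the universal chains behind "cup product = diagonal pull-back of the cross
product" (Hatcher (2002), §3.B pp. 277–280; Bredon (1993), VI §4), used in the sequel to
compare the de Rham (wedge) and Alexander–Whitney (cup) products.

Also recorded: generic `TupleChain` lemmas (`push_push`, `push_congr`, vertex-support bookkeeping
`VertsIn`), the support of the shuffle chains (`vertsIn_shuffle`: vertices in the box
`[0,p] × [0,n-p]`; `isPath_of_mem_support_shuffle`: every tuple is a lattice path with unit steps;
`eq_stdPath_of_mem_support_shuffle`, `shuffle_apply_stdPath`: the straight path `R^p U^q`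
(`stdPath`) is the only tuple whose first coordinate is `i` at every index `i ≤ p`, and it has
coefficient `+1`), and vanishing above the diagonal (`shuffle_eq_zero_of_lt`).

Not here: the realization against singular simplices of a product space `X × Y` (push-forward of
`shuffle` along `(σ ∘ pr₁, τ ∘ pr₂)`), the Eilenberg–Zilber quasi-isomorphism, the cross product.

Everything is definitions with bodies and proved lemmas; nothing is asserted.

## References

* S. Eilenberg, S. Mac Lane, On the groups `H(Π,n)`. I, Ann. of Math. 58 (1953), §5. [folklore attribution]
* A. Hatcher, *Algebraic Topology*, CUP 2002, §3.B pp. 277–278 (shuffles), §2.1 (cones). [HatcherAT2002]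
* G. E. Bredon, *Topology and Geometry*, GTM 139 (1993), IV §16, VI §1. [Bredon1993]
-/

noncomputable section

open Finset AlgebraicTopology

universe u

namespace Literature.AlgebraicTopology.SingularHomology

namespace TupleChain

/-! ### Generic complements on tuple chains: iterated push-forward, congruence, vertex supports -/

variable {P : Type u} {P' : Type u} {P'' : Type u} {n : ℕ}

/-- Push-forwards compose: `g♯ (f♯ x) = (g ∘ f)♯ x`. [folklore] -/
theorem push_push (f : P → P') (g : P' → P'') (n : ℕ) (x : TupleChain P n) :
    push g n (push f n x) = push (g ∘ f) n x := by
  induction x using Finsupp.induction_linear with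
  | zero => simp
  | add x y hx hy => simp only [map_add, hx, hy]
  | single v c => simp only [push_single, Function.comp_assoc]

/-- Push-forward along the identity. [folklore] -/
theorem push_id_apply (n : ℕ) (x : TupleChain P n) : push (fun v : P ↦ v) n x = x := by
  induction x using Finsupp.induction_linear with
  | zero => simp
  | add x y hx hy => simp only [map_add, hx, hy]
  | single v c => rw [push_single]; rfl

variable (s : Set P)

/-- **All vertices of the tuples in the support of a tuple chain lie in `s`.** [folklore] -/
def VertsIn (x : TupleChain P n) : Prop :=
  ∀ w ∈ x.support, ∀ k, w k ∈ s

variable {s}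

/-- The zero chain. [folklore] -/
theorem vertsIn_zero : VertsIn s (0 : TupleChain P n) := fun w hw ↦ by simp at hw

/-- An elementary chain on a tuple with entries in `s`. [folklore] -/
theorem vertsIn_single {v : Fin (n + 1) → P} (hv : ∀ k, v k ∈ s) (c : ℤ) :
    VertsIn s (Finsupp.single v c) := fun w hw k ↦ by
  classical
  have hw' := Finsupp.support_single_subset hw
  rw [Finset.mem_singleton] at hw'
  exact hw' ▸ hv k

/-- `VertsIn` is stable under addition. [folklore] -/
theorem VertsIn.add {x y : TupleChain P n} (hx : VertsIn s x) (hy : VertsIn s y) : VertsIn s (x + y) :=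
  fun w hw k ↦ by
    classical
    rcases Finset.mem_union.mp (Finsupp.support_add hw) with h | h
    · exact hx w h k
    · exact hy w h k

/-- `VertsIn` is stable under integer multiples. [folklore] -/
theorem VertsIn.zsmul {x : TupleChain P n} (hx : VertsIn s x) (c : ℤ) : VertsIn s (c • x) :=
  fun w hw k ↦ hx w (Finsupp.support_smul hw) k

/-- `VertsIn` is stable under finite sums. [folklore] -/
theorem VertsIn.sum {ι : Type*} (t : Finset ι) {f : ι → TupleChain P n} (h : ∀ i ∈ t, VertsIn s (f i)) :
    VertsIn s (∑ i ∈ t, f i) := by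
  classical
  induction t using Finset.induction_on with
  | empty => simpa using (vertsIn_zero (s := s) (n := n))
  | insert a t ha ih =>
    rw [Finset.sum_insert ha]
    exact (h a (Finset.mem_insert_self a t)).add (ih fun i hi ↦ h i (Finset.mem_insert_of_mem hi))

/-- Vertex supports under a linear push-forward of tuples `F` (the common shape of `cone`, `push`
and the face maps). [folklore] -/
theorem VertsIn.lmapDomain {m : ℕ} {s' : Set P'} {F : (Fin (n + 1) → P) → (Fin (m + 1) → P')}
    (hF : ∀ v : Fin (n + 1) → P, (∀ k, v k ∈ s) → ∀ k, F v k ∈ s') {x : TupleChain P n} (hx : VertsIn s x) :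
    VertsIn s' (Finsupp.lmapDomain ℤ ℤ F x) := by
  intro w hw k
  classical
  obtain ⟨v, hv, rfl⟩ := Finset.mem_image.mp (Finsupp.mapDomain_support hw)
  exact hF v (hx v hv) k

/-- Coning with an apex in `s` keeps the vertices in `s`. [folklore] -/
theorem VertsIn.cone {x : TupleChain P n} (hx : VertsIn s x) {b : P} (hb : b ∈ s) : VertsIn s (cone b x) :=
  VertsIn.lmapDomain (fun v hv k ↦ Fin.cases (by simpa using hb) (fun l ↦ by simpa using hv l) k) hx

/-- Push-forward along a map sending `s` into `s'`. [folklore] -/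
theorem VertsIn.push {s' : Set P'} {g : P → P'} (hg : ∀ v ∈ s, g v ∈ s') {x : TupleChain P n}
    (hx : VertsIn s x) : VertsIn s' (push g n x) :=
  VertsIn.lmapDomain (fun _ hv k ↦ hg _ (hv k)) hx

/-- The boundary does not create vertices. [folklore] -/
theorem VertsIn.bd {x : TupleChain P (n + 1)} (hx : VertsIn s x) : VertsIn s (TupleChain.bd n x) := by
  rw [TupleChain.bd, AlternatingFaceMapComplex.objD, ModuleCat.hom_sum, LinearMap.coe_sum, Finset.sum_apply]
  refine VertsIn.sum _ fun i _ ↦ ?_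
  rw [ModuleCat.hom_zsmul, LinearMap.smul_apply, tupleSMod_δ_hom]
  exact (VertsIn.lmapDomain (fun v hv k ↦ hv _) hx).zsmul _

/-- Enlarging the vertex set. [folklore] -/
theorem VertsIn.mono {s' : Set P} (h : s ⊆ s') {x : TupleChain P n} (hx : VertsIn s x) : VertsIn s' x :=
  fun w hw k ↦ h (hx w hw k)

/-- **Congruence of push-forwards**: two vertex maps that agree on the vertices of `x` push `x`
forward to the same chain. [folklore] -/
theorem push_congr {f g : P → P'} {x : TupleChain P n} (hx : VertsIn s x) (hfg : ∀ v ∈ s, f v = g v) :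
    push f n x = push g n x := by
  classical
  change Finsupp.mapDomain _ x = Finsupp.mapDomain _ x
  refine Finsupp.mapDomain_congr fun w hw ↦ ?_
  funext k
  exact hfg _ (hx w hw k)

end TupleChain

/-! ### The lattice `ℕ × ℕ` and its coface maps -/

namespace ShuffleChains

open TupleChain

/-- The coface map `δᵢ : ℕ → ℕ` skipping the value `i`: `k ↦ k` for `k < i`, `k ↦ k + 1` for
`i ≤ k`. [folklore] -/
def skip (i k : ℕ) : ℕ := if k < i then k else k + 1

/-- `skip i k = k` below `i`. [folklore] -/
theorem skip_of_lt {i k : ℕ} (h : k < i) : skip i k = k := if_pos h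

/-- `skip i k = k + 1` from `i` on. [folklore] -/
theorem skip_of_le {i k : ℕ} (h : i ≤ k) : skip i k = k + 1 := if_neg (Nat.not_lt.mpr h)

/-- `skip 0` is the successor. [folklore] -/
@[simp]
theorem skip_zero (k : ℕ) : skip 0 k = k + 1 := skip_of_le (Nat.zero_le k)

/-- **The cosimplicial identity** `δⱼ₊₁ ∘ δᵢ = δᵢ ∘ δⱼ` for `i ≤ j`. [folklore] -/
theorem skip_succ_comp_skip {i j : ℕ} (h : i ≤ j) : skip (j + 1) ∘ skip i = skip i ∘ skip j := by
  funext k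
  simp only [Function.comp_apply, skip]
  split_ifs <;> omega

/-- `skip i` agrees with `Fin.succAbove i` on values. [folklore] -/
theorem val_succAbove {m : ℕ} (i : Fin (m + 1)) (k : Fin m) : ((Fin.succAbove i k : Fin (m + 1)) : ℕ) = skip i k := by
  rcases lt_or_ge (k : ℕ) (i : ℕ) with h | h
  · rw [Fin.succAbove_of_castSucc_lt i k (by simpa [Fin.lt_def] using h), skip_of_lt h]
    rfl
  · rw [Fin.succAbove_of_le_castSucc i k (by simpa [Fin.le_def] using h), skip_of_le h]
    rfl

/-- The lattice of vertices `ℕ × ℕ`. [folklore] -/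
abbrev V : Type := ℕ × ℕ

/-- The origin `(0,0)`, apex of all cones. [folklore] -/
abbrev o : V := ((0 : ℕ), (0 : ℕ))

/-- The horizontal coface map `Rᵢ = δᵢ × 1`. [folklore] -/
def faceR (i : ℕ) : V → V := Prod.map (skip i) id

/-- The vertical coface map `Uⱼ = 1 × δⱼ`. [folklore] -/
def faceU (j : ℕ) : V → V := Prod.map id (skip j)

/-- Components of `Rᵢ`. [folklore] -/
@[simp] theorem faceR_apply (i : ℕ) (v : V) : faceR i v = (skip i v.1, v.2) := rfl
/-- Components of `Uⱼ`. [folklore] -/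
@[simp] theorem faceU_apply (j : ℕ) (v : V) : faceU j v = (v.1, skip j v.2) := rfl

/-- Horizontal and vertical cofaces commute. [folklore] -/
theorem faceR_comp_faceU (i j : ℕ) : faceR i ∘ faceU j = faceU j ∘ faceR i := by
  funext v; rfl

/-- Cosimplicial identity for the horizontal cofaces. [folklore] -/
theorem faceR_succ_comp_faceR {i j : ℕ} (h : i ≤ j) : faceR (j + 1) ∘ faceR i = faceR i ∘ faceR j := by
  funext v
  simp only [Function.comp_apply, faceR_apply, Prod.mk.injEq, and_true]
  exact congrFun (skip_succ_comp_skip h) v.1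

/-- Cosimplicial identity for the vertical cofaces. [folklore] -/
theorem faceU_succ_comp_faceU {i j : ℕ} (h : i ≤ j) : faceU (j + 1) ∘ faceU i = faceU i ∘ faceU j := by
  funext v
  simp only [Function.comp_apply, faceU_apply, Prod.mk.injEq, true_and]
  exact congrFun (skip_succ_comp_skip h) v.2

/-- Positive horizontal cofaces fix the origin. [folklore] -/
theorem faceR_succ_o (i : ℕ) : faceR (i + 1) o = o := by
  simp [skip_of_lt (Nat.succ_pos i)]

/-- Positive vertical cofaces fix the origin. [folklore] -/
theorem faceU_succ_o (j : ℕ) : faceU (j + 1) o = o := by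
  simp [skip_of_lt (Nat.succ_pos j)]

/-- `R₀ o = (1,0)`. [folklore] -/
@[simp] theorem faceR_zero_o : faceR 0 o = ((1 : ℕ), (0 : ℕ)) := by simp
/-- `U₀ o = (0,1)`. [folklore] -/
@[simp] theorem faceU_zero_o : faceU 0 o = ((0 : ℕ), (1 : ℕ)) := by simp

/-! ### The universal shuffle chains -/

/-- **The universal `(p, n-p)`-shuffle chain** `shuffle n p ∈ TupleChain (ℕ × ℕ) n`: the signed sum,
over the monotone lattice paths from `(0,0)` to `(p, n-p)`, of the `n`-tuples of their vertices
(Eilenberg–Mac Lane's shuffle map on the universal pair of simplices; Hatcher (2002), §3.B), defined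
by the first-vertex cone recursion; `0` for `p > n`. [cite: HatcherAT2002, §3.B pp. 277–278] -/
def shuffle : (n : ℕ) → (p : ℕ) → TupleChain V n
  | 0, 0 => Finsupp.single (fun _ ↦ o) 1
  | 0, _ + 1 => 0
  | n + 1, 0 => cone o (push (faceU 0) n (shuffle n 0))
  | n + 1, p + 1 => cone o (push (faceR 0) n (shuffle n p)) +
      ((-1 : ℤ) ^ (p + 1)) • cone o (push (faceU 0) n (shuffle n (p + 1)))

/-- The unique `(0,0)`-shuffle is the origin. [folklore] -/
@[simp] theorem shuffle_zero_zero : shuffle 0 0 = Finsupp.single (fun _ ↦ o) 1 := rfl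
/-- No `(p+1)`-shuffles in degree `0`. [folklore] -/
@[simp] theorem shuffle_zero_succ (p : ℕ) : shuffle 0 (p + 1) = 0 := rfl
/-- The recursion at `p = 0` (only an up-step is possible). [folklore] -/
theorem shuffle_succ_zero (n : ℕ) : shuffle (n + 1) 0 = cone o (push (faceU 0) n (shuffle n 0)) := rfl
/-- The recursion at `p + 1` (first step right, or up with the shuffle sign `(-1)ᵖ⁺¹`). [folklore] -/
theorem shuffle_succ_succ (n p : ℕ) : shuffle (n + 1) (p + 1) = cone o (push (faceR 0) n (shuffle n p)) +
    ((-1 : ℤ) ^ (p + 1)) • cone o (push (faceU 0) n (shuffle n (p + 1))) := rfl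

/-- **No paths with more than `n` right-steps**: `shuffle n p = 0` for `n < p`. [folklore] -/
theorem shuffle_eq_zero_of_lt : ∀ {n p : ℕ}, n < p → shuffle n p = 0
  | 0, p + 1, _ => rfl
  | n + 1, p + 1, h => by
    rw [shuffle_succ_succ, shuffle_eq_zero_of_lt (by omega : n < p), shuffle_eq_zero_of_lt (by omega : n < p + 1)]
    simp

/-- The box `[0,p] × [0,q]` of lattice points. [folklore] -/
def box (p q : ℕ) : Set V := {v | v.1 ≤ p ∧ v.2 ≤ q}

/-- The origin lies in every box. [folklore] -/
theorem o_mem_box (p q : ℕ) : o ∈ box p q := ⟨Nat.zero_le _, Nat.zero_le _⟩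

/-- **The vertices of `shuffle n p` lie in the box `[0,p] × [0,n-p]`.** [folklore] -/
theorem vertsIn_shuffle : ∀ (n p : ℕ), VertsIn (box p (n - p)) (shuffle n p)
  | 0, 0 => vertsIn_single (fun _ ↦ o_mem_box 0 0) 1
  | 0, p + 1 => vertsIn_zero
  | n + 1, 0 => by
    rw [shuffle_succ_zero]
    refine VertsIn.cone (VertsIn.push (fun v hv ↦ ?_) (vertsIn_shuffle n 0)) (o_mem_box _ _)
    simp only [box, Set.mem_setOf_eq, faceU_apply, skip_zero] at hv ⊢
    omega
  | n + 1, p + 1 => by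
    rw [shuffle_succ_succ]
    refine VertsIn.add (VertsIn.cone (VertsIn.push (fun v hv ↦ ?_) (vertsIn_shuffle n p)) (o_mem_box _ _))
      (VertsIn.zsmul (VertsIn.cone ?_ (o_mem_box _ _)) _)
    · simp only [box, Set.mem_setOf_eq, faceR_apply, skip_zero] at hv ⊢
      omega
    · rcases Nat.lt_or_ge n (p + 1) with h | h
      · rw [shuffle_eq_zero_of_lt h, map_zero]; exact vertsIn_zero
      · refine VertsIn.push (fun v hv ↦ ?_) (vertsIn_shuffle n (p + 1))
        simp only [box, Set.mem_setOf_eq, faceU_apply, skip_zero] at hv ⊢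
        omega

/-! ### The Eilenberg–Zilber boundary formula -/

/-- The horizontal boundary operator `∂ᴿ_p = ∑_{i ≤ p} (-1)ⁱ Rᵢ` ("`∂σ × τ`" on universal chains). [folklore] -/
def bdR (n p : ℕ) (x : TupleChain V n) : TupleChain V n :=
  ∑ i ∈ range (p + 1), ((-1 : ℤ) ^ i) • push (faceR i) n x

/-- The vertical boundary operator `∂ᵁ_q = ∑_{j ≤ q} (-1)ʲ Uⱼ` ("`σ × ∂τ`" on universal chains). [folklore] -/
def bdU (n q : ℕ) (x : TupleChain V n) : TupleChain V n :=
  ∑ j ∈ range (q + 1), ((-1 : ℤ) ^ j) • push (faceU j) n x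

/-- Unfolding `∂ᴿ`. [folklore] -/
theorem bdR_apply (n p : ℕ) (x : TupleChain V n) :
    bdR n p x = ∑ i ∈ range (p + 1), ((-1 : ℤ) ^ i) • push (faceR i) n x := rfl

/-- Unfolding `∂ᵁ`. [folklore] -/
theorem bdU_apply (n q : ℕ) (x : TupleChain V n) :
    bdU n q x = ∑ j ∈ range (q + 1), ((-1 : ℤ) ^ j) • push (faceU j) n x := rfl

/-- `∂ᴿ` is additive. [folklore] -/
@[simp] theorem bdR_add (n p : ℕ) (x y : TupleChain V n) : bdR n p (x + y) = bdR n p x + bdR n p y := by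
  simp [bdR, Finset.sum_add_distrib]
/-- `∂ᵁ` is additive. [folklore] -/
@[simp] theorem bdU_add (n q : ℕ) (x y : TupleChain V n) : bdU n q (x + y) = bdU n q x + bdU n q y := by
  simp [bdU, Finset.sum_add_distrib]
/-- `∂ᴿ` commutes with integer scalars. [folklore] -/
@[simp] theorem bdR_zsmul (n p : ℕ) (c : ℤ) (x : TupleChain V n) : bdR n p (c • x) = c • bdR n p x := by
  simp [bdR, Finset.smul_sum, smul_comm c]
/-- `∂ᵁ` commutes with integer scalars. [folklore] -/
@[simp] theorem bdU_zsmul (n q : ℕ) (c : ℤ) (x : TupleChain V n) : bdU n q (c • x) = c • bdU n q x := by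
  simp [bdU, Finset.smul_sum, smul_comm c]
/-- `∂ᴿ 0 = 0`. [folklore] -/
@[simp] theorem bdR_zero (n p : ℕ) : bdR n p (0 : TupleChain V n) = 0 := by simp [bdR]
/-- `∂ᵁ 0 = 0`. [folklore] -/
@[simp] theorem bdU_zero (n q : ℕ) : bdU n q (0 : TupleChain V n) = 0 := by simp [bdU]
/-- `∂ᴿ` commutes with negation. [folklore] -/
@[simp] theorem bdR_neg (n p : ℕ) (x : TupleChain V n) : bdR n p (-x) = -bdR n p x := by
  simpa using bdR_zsmul n p (-1) x
/-- `∂ᵁ` commutes with negation. [folklore] -/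
@[simp] theorem bdU_neg (n q : ℕ) (x : TupleChain V n) : bdU n q (-x) = -bdU n q x := by
  simpa using bdU_zsmul n q (-1) x
/-- `∂ᴿ` commutes with subtraction. [folklore] -/
@[simp] theorem bdR_sub (n p : ℕ) (x y : TupleChain V n) : bdR n p (x - y) = bdR n p x - bdR n p y := by
  simp [sub_eq_add_neg]
/-- `∂ᵁ` commutes with subtraction. [folklore] -/
@[simp] theorem bdU_sub (n q : ℕ) (x y : TupleChain V n) : bdU n q (x - y) = bdU n q x - bdU n q y := by
  simp [sub_eq_add_neg]

/-- `∂ᴿ_0 = R₀`. [folklore] -/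
theorem bdR_zero_apply (n : ℕ) (x : TupleChain V n) : bdR n 0 x = push (faceR 0) n x := by
  simp [bdR_apply]

/-- Splitting off `i = 0`: `∂ᴿ_{p+1} y = R₀ y - ∑_{i ≤ p} (-1)ⁱ R_{i+1} y`. [folklore] -/
theorem bdR_succ_apply (n p : ℕ) (y : TupleChain V n) :
    bdR n (p + 1) y = push (faceR 0) n y - ∑ i ∈ range (p + 1), ((-1 : ℤ) ^ i) • push (faceR (i + 1)) n y := by
  rw [bdR_apply, Finset.sum_range_succ' _ (p + 1)]
  simp only [pow_zero, one_smul, pow_succ, mul_neg, mul_one, neg_smul, Finset.sum_neg_distrib]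
  abel

/-- Splitting off `j = 0`: `∂ᵁ_{q+1} y = U₀ y - ∑_{j ≤ q} (-1)ʲ U_{j+1} y`. [folklore] -/
theorem bdU_succ_apply (n q : ℕ) (y : TupleChain V n) :
    bdU n (q + 1) y = push (faceU 0) n y - ∑ j ∈ range (q + 1), ((-1 : ℤ) ^ j) • push (faceU (j + 1)) n y := by
  rw [bdU_apply, Finset.sum_range_succ' _ (q + 1)]
  simp only [pow_zero, one_smul, pow_succ, mul_neg, mul_one, neg_smul, Finset.sum_neg_distrib]
  abel

/-- Shifted horizontal faces of a cone with apex `o` (they fix the apex). [folklore] -/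
theorem sum_faceR_succ_cone (n p : ℕ) (y : TupleChain V n) :
    (∑ i ∈ range (p + 1), ((-1 : ℤ) ^ i) • push (faceR (i + 1)) (n + 1) (cone o y)) =
      cone o (∑ i ∈ range (p + 1), ((-1 : ℤ) ^ i) • push (faceR (i + 1)) n y) := by
  simp only [map_sum, map_zsmul, push_cone, faceR_succ_o]

/-- Shifted vertical faces of a cone with apex `o`. [folklore] -/
theorem sum_faceU_succ_cone (n q : ℕ) (y : TupleChain V n) :
    (∑ j ∈ range (q + 1), ((-1 : ℤ) ^ j) • push (faceU (j + 1)) (n + 1) (cone o y)) =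
      cone o (∑ j ∈ range (q + 1), ((-1 : ℤ) ^ j) • push (faceU (j + 1)) n y) := by
  simp only [map_sum, map_zsmul, push_cone, faceU_succ_o]

/-- `R_{i+1} R₀ = R₀ Rᵢ`. [folklore] -/
theorem push_faceR_succ_push_faceR_zero (n i : ℕ) (x : TupleChain V n) :
    push (faceR (i + 1)) n (push (faceR 0) n x) = push (faceR 0) n (push (faceR i) n x) := by
  rw [push_push, push_push, faceR_succ_comp_faceR (Nat.zero_le i)]

/-- `U_{j+1} U₀ = U₀ Uⱼ`. [folklore] -/
theorem push_faceU_succ_push_faceU_zero (n j : ℕ) (x : TupleChain V n) :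
    push (faceU (j + 1)) n (push (faceU 0) n x) = push (faceU 0) n (push (faceU j) n x) := by
  rw [push_push, push_push, faceU_succ_comp_faceU (Nat.zero_le j)]

/-- `Rᵢ Uⱼ = Uⱼ Rᵢ`. [folklore] -/
theorem push_faceR_push_faceU (n i j : ℕ) (x : TupleChain V n) :
    push (faceR i) n (push (faceU j) n x) = push (faceU j) n (push (faceR i) n x) := by
  rw [push_push, push_push, faceR_comp_faceU]

/-- `(∑_{i ≤ p} (-1)ⁱ R_{i+1}) (R₀ x) = R₀ (∂ᴿ_p x)`. [folklore] -/
theorem sum_faceR_succ_push_faceR_zero (n p : ℕ) (x : TupleChain V n) :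
    (∑ i ∈ range (p + 1), ((-1 : ℤ) ^ i) • push (faceR (i + 1)) n (push (faceR 0) n x)) =
      push (faceR 0) n (bdR n p x) := by
  simp only [push_faceR_succ_push_faceR_zero, bdR_apply, map_sum, map_zsmul]

/-- `(∑_{i ≤ p} (-1)ⁱ R_{i+1}) (U₀ x) = U₀ ((∑_{i ≤ p} (-1)ⁱ R_{i+1}) x)`. [folklore] -/
theorem sum_faceR_succ_push_faceU_zero (n p : ℕ) (x : TupleChain V n) :
    (∑ i ∈ range (p + 1), ((-1 : ℤ) ^ i) • push (faceR (i + 1)) n (push (faceU 0) n x)) =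
      push (faceU 0) n (∑ i ∈ range (p + 1), ((-1 : ℤ) ^ i) • push (faceR (i + 1)) n x) := by
  simp only [push_faceR_push_faceU, map_sum, map_zsmul]

/-- `(∑_{j ≤ q} (-1)ʲ U_{j+1}) (U₀ x) = U₀ (∂ᵁ_q x)`. [folklore] -/
theorem sum_faceU_succ_push_faceU_zero (n q : ℕ) (x : TupleChain V n) :
    (∑ j ∈ range (q + 1), ((-1 : ℤ) ^ j) • push (faceU (j + 1)) n (push (faceU 0) n x)) =
      push (faceU 0) n (bdU n q x) := by
  simp only [push_faceU_succ_push_faceU_zero, bdU_apply, map_sum, map_zsmul]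

/-- `(∑_{j ≤ q} (-1)ʲ U_{j+1}) (R₀ x) = R₀ ((∑_{j ≤ q} (-1)ʲ U_{j+1}) x)`. [folklore] -/
theorem sum_faceU_succ_push_faceR_zero (n q : ℕ) (x : TupleChain V n) :
    (∑ j ∈ range (q + 1), ((-1 : ℤ) ^ j) • push (faceU (j + 1)) n (push (faceR 0) n x)) =
      push (faceR 0) n (∑ j ∈ range (q + 1), ((-1 : ℤ) ^ j) • push (faceU (j + 1)) n x) := by
  simp only [← push_faceR_push_faceU, map_sum, map_zsmul]

/-- `shuffle n (p-1)`, with the convention `0` for `p = 0` (the chain behind an initial right-step). [folklore] -/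
def shuffleR (n : ℕ) : ℕ → TupleChain V n
  | 0 => 0
  | p + 1 => shuffle n p

/-- `shuffleR n 0 = 0`. [folklore] -/
@[simp] theorem shuffleR_zero (n : ℕ) : shuffleR n 0 = 0 := rfl
/-- `shuffleR n (p+1) = shuffle n p`. [folklore] -/
@[simp] theorem shuffleR_succ (n p : ℕ) : shuffleR n (p + 1) = shuffle n p := rfl

/-- The cone recursion, uniformly in `p`:
`shuffle (n+1) p = o · R₀(shuffleR n p) + (-1)ᵖ o · U₀(shuffle n p)`. [folklore] -/
theorem shuffle_succ_eq (n p : ℕ) : shuffle (n + 1) p =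
    cone o (push (faceR 0) n (shuffleR n p)) + ((-1 : ℤ) ^ p) • cone o (push (faceU 0) n (shuffle n p)) := by
  rcases p with _ | p
  · simp [shuffle_succ_zero]
  · rfl

/-- Base case, vertical edge: `∂ (shuffle 1 0) = ∂ᵁ_1 [o]`. [folklore] -/
theorem bd_shuffle_one_zero : bd 0 (shuffle 1 0) = bdU 0 1 (shuffle 0 0) := by
  rw [shuffle_succ_zero, shuffle_zero_zero, push_single, bd_cone_single_zero, bdU_apply, Finset.sum_range_succ,
    Finset.sum_range_one]
  simp only [pow_zero, one_smul, push_single, pow_one, neg_smul]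
  have h1 : (faceU 1 ∘ fun _ : Fin (0 + 1) ↦ o) = fun _ ↦ o := by
    funext k; simp [skip_of_lt Nat.one_pos]
  have h0 : (faceU 0 ∘ fun _ : Fin (0 + 1) ↦ o) = fun _ ↦ ((0 : ℕ), (1 : ℕ)) := by
    funext k; simp
  rw [h1, h0]
  abel

/-- Base case, horizontal edge: `∂ (shuffle 1 1) = ∂ᴿ_1 [o]`. [folklore] -/
theorem bd_shuffle_one_one : bd 0 (shuffle 1 1) = bdR 0 1 (shuffle 0 0) := by
  rw [shuffle_succ_succ, shuffle_zero_succ, map_zero, map_zero, smul_zero, add_zero, shuffle_zero_zero, push_single,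
    bd_cone_single_zero, bdR_apply, Finset.sum_range_succ, Finset.sum_range_one]
  simp only [pow_zero, one_smul, push_single, pow_one, neg_smul]
  have h1 : (faceR 1 ∘ fun _ : Fin (0 + 1) ↦ o) = fun _ ↦ o := by
    funext k; simp [skip_of_lt Nat.one_pos]
  have h0 : (faceR 0 ∘ fun _ : Fin (0 + 1) ↦ o) = fun _ ↦ ((1 : ℕ), (0 : ℕ)) := by
    funext k; simp
  rw [h1, h0]
  abel

/-- `(-1)ᵖ (-1)ᵖ = 1` in `ℤ`. [folklore] -/
theorem neg_one_pow_mul_self (p : ℕ) : ((-1 : ℤ) ^ p) * ((-1 : ℤ) ^ p) = 1 := by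
  rw [← pow_add, ← two_mul, pow_mul, neg_one_sq, one_pow]

/-- **The Eilenberg–Zilber boundary formula** (joint induction on the degree): the vertical-edge
case `∂ shuffle (n+1) 0 = ∂ᵁ_{n+1} shuffle n 0` and, for `p + q = n`,
`∂ shuffle (n+1) (p+1) = ∂ᴿ_{p+1} shuffle n p + (-1)ᵖ⁺¹ ∂ᵁ_q shuffle n (p+1)`.
[cite: HatcherAT2002, §3.B pp. 277–278] -/
theorem bd_shuffle_aux : ∀ n : ℕ,
    bd n (shuffle (n + 1) 0) = bdU n (n + 1) (shuffle n 0) ∧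
      ∀ p q : ℕ, p + q = n → bd n (shuffle (n + 1) (p + 1)) =
        bdR n (p + 1) (shuffle n p) + ((-1 : ℤ) ^ (p + 1)) • bdU n q (shuffle n (p + 1))
  | 0 => ⟨bd_shuffle_one_zero, fun p q hpq ↦ by
      obtain ⟨rfl, rfl⟩ : p = 0 ∧ q = 0 := by omega
      rw [bd_shuffle_one_one, shuffle_zero_succ, bdU_zero, smul_zero, add_zero]⟩
  | n + 1 => by
    obtain ⟨ih0, ihs⟩ := bd_shuffle_aux n
    -- the induction hypothesis, uniformly in `p`
    have ihu : ∀ p q : ℕ, p + q = n + 1 → bd n (shuffle (n + 1) p) =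
        bdR n p (shuffleR n p) + ((-1 : ℤ) ^ p) • bdU n q (shuffle n p) := by
      intro p q hpq
      rcases p with _ | p
      · rw [shuffleR_zero, bdR_zero, zero_add, pow_zero, one_smul, ih0, show q = n + 1 by omega]
      · rw [shuffleR_succ]
        exact ihs p q (by omega)
    refine ⟨?_, fun p q hpq ↦ ?_⟩
    · -- vertical edge `p = 0`
      rw [shuffle_succ_zero, bd_cone_succ, ← push_bd, ih0, shuffle_succ_zero, bdU_succ_apply (n + 1) (n + 1),
        sum_faceU_succ_cone, sum_faceU_succ_push_faceU_zero]
    · have hε : ((-1 : ℤ) ^ (p + 1)) = -((-1 : ℤ) ^ p) := by rw [pow_succ, mul_neg_one]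
      rcases q with _ | q
      · -- `q = 0`: the all-right path, `p = n + 1`
        obtain rfl : p = n + 1 := by omega
        have hz1 : shuffle (n + 1) (n + 1 + 1) = 0 := shuffle_eq_zero_of_lt (by omega)
        have hz2 : shuffle n (n + 1) = 0 := shuffle_eq_zero_of_lt (by omega)
        rw [shuffle_succ_succ, hz1, map_zero, map_zero, smul_zero, add_zero, bdU_zero, smul_zero, add_zero,
          bd_cone_succ, ← push_bd, ihu (n + 1) 0 (by omega), shuffleR_succ, hz2, bdU_zero, smul_zero, add_zero,
          shuffle_succ_eq n (n + 1), shuffleR_succ, hz2, map_zero, map_zero, smul_zero, add_zero,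
          bdR_succ_apply (n + 1) (n + 1), sum_faceR_succ_cone, sum_faceR_succ_push_faceR_zero]
      · -- generic case `p + q + 1 = n + 1`
        have hb1 : (∑ i ∈ range (p + 1), ((-1 : ℤ) ^ i) • push (faceR (i + 1)) n (shuffle n p)) =
            push (faceR 0) n (shuffle n p) - bdR n (p + 1) (shuffle n p) := by
          rw [bdR_succ_apply]; abel
        have hb2 : (∑ j ∈ range (q + 1), ((-1 : ℤ) ^ j) • push (faceU (j + 1)) n (shuffle n p)) =
            push (faceU 0) n (shuffle n p) - bdU n (q + 1) (shuffle n p) := by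
          rw [bdU_succ_apply]; abel
        rw [shuffle_succ_succ (n + 1) p, map_add, map_zsmul, bd_cone_succ, bd_cone_succ, ← push_bd, ← push_bd,
          ihu p (q + 1) (by omega), ihu (p + 1) q (by omega), shuffleR_succ, shuffle_succ_eq n p,
          shuffle_succ_succ n p]
        simp only [map_add, map_zsmul, bdR_add, bdR_zsmul, bdU_add, bdU_zsmul]
        rw [bdR_succ_apply (n + 1) p (cone o (push (faceR 0) n (shuffleR n p))),
          bdR_succ_apply (n + 1) p (cone o (push (faceU 0) n (shuffle n p))),
          bdU_succ_apply (n + 1) q (cone o (push (faceR 0) n (shuffle n p))),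
          bdU_succ_apply (n + 1) q (cone o (push (faceU 0) n (shuffle n (p + 1)))),
          sum_faceR_succ_cone, sum_faceR_succ_cone, sum_faceU_succ_cone, sum_faceU_succ_cone,
          sum_faceR_succ_push_faceR_zero, sum_faceR_succ_push_faceU_zero, sum_faceU_succ_push_faceR_zero,
          sum_faceU_succ_push_faceU_zero, hb1, hb2]
        simp only [map_sub, smul_add, smul_sub, hε, neg_smul, push_faceR_push_faceU]
        abel

/-- **Eilenberg–Zilber boundary formula, vertical edge**: `∂ shuffle (n+1) 0 = ∂ᵁ_{n+1} shuffle n 0`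
(a `0`-simplex times an `(n+1)`-path: only the second factor has a boundary). [cite: HatcherAT2002, §3.B pp. 277–278] -/
theorem bd_shuffle_zero (n : ℕ) : bd n (shuffle (n + 1) 0) = bdU n (n + 1) (shuffle n 0) :=
  (bd_shuffle_aux n).1

/-- **Eilenberg–Zilber boundary formula**: for `p + q = n`,
`∂ shuffle (n+1) (p+1) = ∂ᴿ_{p+1} shuffle n p + (-1)ᵖ⁺¹ ∂ᵁ_q shuffle n (p+1)`, the universal form
of `∂(σ × τ) = ∂σ × τ + (-1)^{p+1} σ × ∂τ` for a `(p+1)`-simplex `σ` and a `q`-simplex `τ`.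
[cite: HatcherAT2002, §3.B pp. 277–278] -/
theorem bd_shuffle_succ {n p q : ℕ} (h : p + q = n) : bd n (shuffle (n + 1) (p + 1)) =
    bdR n (p + 1) (shuffle n p) + ((-1 : ℤ) ^ (p + 1)) • bdU n q (shuffle n (p + 1)) :=
  (bd_shuffle_aux n).2 p q h

/-- The boundary formula uniformly in `p`: for `p + q = n + 1`,
`∂ shuffle (n+1) p = ∂ᴿ_p (shuffleR n p) + (-1)ᵖ ∂ᵁ_q shuffle n p`. [cite: HatcherAT2002, §3.B pp. 277–278] -/
theorem bd_shuffle {n p q : ℕ} (h : p + q = n + 1) : bd n (shuffle (n + 1) p) =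
    bdR n p (shuffleR n p) + ((-1 : ℤ) ^ p) • bdU n q (shuffle n p) := by
  rcases p with _ | p
  · rw [shuffleR_zero, bdR_zero, zero_add, pow_zero, one_smul, bd_shuffle_zero, show q = n + 1 by omega]
  · exact bd_shuffle_succ (by omega)

/-! ### The support of the shuffle chains: lattice paths, the straight path -/

/-- **The straight path** `R^p U^{n-p}`: `i ↦ (min i p, i - min i p)` — the vertices of the shuffle
simplex `[v₀,…,v_p] × v_p ∪ v_p × [w₀, …, w_q]` met by the Alexander–Whitney front/back faces
(Hatcher (2002), §3.B). [folklore] -/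
def stdPath (n p : ℕ) : Fin (n + 1) → V := fun i ↦ (min (i : ℕ) p, (i : ℕ) - min (i : ℕ) p)

/-- Unfolding the straight path. [folklore] -/
theorem stdPath_apply (n p : ℕ) (i : Fin (n + 1)) : stdPath n p i = (min (i : ℕ) p, (i : ℕ) - min (i : ℕ) p) := rfl

/-- On the front `p + 1` indices the straight path runs along the first axis. [folklore] -/
theorem stdPath_apply_of_le {n p : ℕ} {i : Fin (n + 1)} (h : (i : ℕ) ≤ p) : stdPath n p i = ((i : ℕ), 0) := by
  simp [stdPath_apply, Nat.min_eq_left h]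

/-- On the back indices the straight path runs along the second axis. [folklore] -/
theorem stdPath_apply_of_ge {n p : ℕ} {i : Fin (n + 1)} (h : p ≤ (i : ℕ)) : stdPath n p i = (p, (i : ℕ) - p) := by
  simp [stdPath_apply, Nat.min_eq_right h]

/-- The straight path in degree `0` is the origin. [folklore] -/
theorem stdPath_zero_zero : stdPath 0 0 = fun _ ↦ o := by
  funext i
  simp [stdPath_apply]

/-- The straight path starts with a right-step when `p ≥ 1`. [folklore] -/
theorem stdPath_succ_succ (n p : ℕ) : stdPath (n + 1) (p + 1) = Fin.cons o (faceR 0 ∘ stdPath n p) := by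
  funext i
  refine Fin.cases ?_ (fun j ↦ ?_) i
  · simp [stdPath_apply]
  · simp only [stdPath_apply, Fin.val_succ, Fin.cons_succ, Function.comp_apply, faceR_apply, skip_zero, Prod.mk.injEq]
    omega

/-- The straight path with `p = 0` goes straight up. [folklore] -/
theorem stdPath_succ_zero (n : ℕ) : stdPath (n + 1) 0 = Fin.cons o (faceU 0 ∘ stdPath n 0) := by
  funext i
  refine Fin.cases ?_ (fun j ↦ ?_) i
  · simp [stdPath_apply]
  · simp only [stdPath_apply, Fin.val_succ, Fin.cons_succ, Function.comp_apply, faceU_apply, skip_zero,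
      Nat.zero_le, Nat.min_eq_right, Prod.mk.injEq, true_and]
    omega

/-- **There is exactly one `(0, n)`-shuffle**: `shuffle n 0 = [straight-up path]`. [folklore] -/
theorem shuffle_zero_right : ∀ n : ℕ, shuffle n 0 = Finsupp.single (stdPath n 0) 1
  | 0 => by rw [shuffle_zero_zero, stdPath_zero_zero]
  | n + 1 => by
    rw [shuffle_succ_zero, shuffle_zero_right n, push_single, cone_single, stdPath_succ_zero]

/-- The support of a cone on a pushed-forward chain. [folklore] -/
theorem exists_of_mem_support_cone_push {P : Type u} {n : ℕ} {b : P} {f : P → P} {x : TupleChain P n}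
    {w : Fin (n + 2) → P} (hw : w ∈ (cone b (push f n x)).support) :
    ∃ v ∈ x.support, w = Fin.cons b (f ∘ v) := by
  classical
  obtain ⟨u, hu, rfl⟩ := Finset.mem_image.mp (Finsupp.mapDomain_support hw)
  obtain ⟨v, hv, rfl⟩ := Finset.mem_image.mp (Finsupp.mapDomain_support hu)
  exact ⟨v, hv, rfl⟩

/-- **Every tuple of `shuffle n p` is a lattice path from the origin with unit steps right (`R₀`) or
up (`U₀`).** [cite: HatcherAT2002, §3.B pp. 277–278] -/
theorem isPath_of_mem_support_shuffle : ∀ {n p : ℕ} {w : Fin (n + 1) → V}, w ∈ (shuffle n p).support →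
    w 0 = o ∧ ∀ i : Fin n, w i.succ = faceR 0 (w i.castSucc) ∨ w i.succ = faceU 0 (w i.castSucc)
  | 0, 0, w, hw => by
    classical
    have h := Finsupp.support_single_subset hw
    rw [Finset.mem_singleton] at h
    subst h
    exact ⟨rfl, fun i ↦ i.elim0⟩
  | 0, p + 1, w, hw => by simp at hw
  | n + 1, p, w, hw => by
    classical
    -- a tuple of either branch is `o` followed by a translated path
    have key : ∀ {f : V → V} {p' : ℕ}, (f = faceR 0 ∨ f = faceU 0) →
        w ∈ (cone o (push f n (shuffle n p'))).support →
        w 0 = o ∧ ∀ i : Fin (n + 1), w i.succ = faceR 0 (w i.castSucc) ∨ w i.succ = faceU 0 (w i.castSucc) := by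
      intro f p' hf hw'
      obtain ⟨v, hv, rfl⟩ := exists_of_mem_support_cone_push hw'
      obtain ⟨hv0, hvs⟩ := isPath_of_mem_support_shuffle hv
      refine ⟨rfl, fun i ↦ Fin.cases ?_ (fun j ↦ ?_) i⟩
      · simp only [Fin.succ_zero_eq_one, Fin.cons_one, Function.comp_apply, hv0, Fin.castSucc_zero, Fin.cons_zero]
        rcases hf with rfl | rfl
        · exact Or.inl rfl
        · exact Or.inr rfl
      · have h1 : (Fin.cons o (f ∘ v) : Fin (n + 2) → V) j.succ.succ = f (v j.succ) := by
          simp only [Fin.cons_succ, Function.comp_apply]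
        have h2 : (Fin.cons o (f ∘ v) : Fin (n + 2) → V) j.succ.castSucc = f (v j.castSucc) := by
          rw [← Fin.succ_castSucc, Fin.cons_succ, Function.comp_apply]
        rw [h1, h2]
        rcases hvs j with h | h <;> rw [h] <;> rcases hf with rfl | rfl
        · exact Or.inl rfl
        · exact Or.inl (by simp)
        · exact Or.inr (by simp)
        · exact Or.inr rfl
    rcases p with _ | p
    · rw [shuffle_succ_zero] at hw
      exact key (Or.inr rfl) hw
    · rw [shuffle_succ_succ] at hw
      rcases Finset.mem_union.mp (Finsupp.support_add hw) with h | h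
      · exact key (Or.inl rfl) h
      · exact key (Or.inr rfl) (Finsupp.support_smul h)

/-- Consequence: along a tuple of `shuffle n p` the first coordinate starts at `0` and increases by at
most one per step; in particular `(w i).1 ≤ i`. [folklore] -/
theorem fst_le_of_mem_support_shuffle {n p : ℕ} {w : Fin (n + 1) → V} (hw : w ∈ (shuffle n p).support)
    (i : Fin (n + 1)) : (w i).1 ≤ i := by
  obtain ⟨h0, hs⟩ := isPath_of_mem_support_shuffle hw
  refine Fin.induction (by simp [h0]) (fun j hj ↦ ?_) i
  rw [Fin.val_castSucc] at hj
  rcases hs j with h | h <;> rw [h] <;> simp only [faceR_apply, faceU_apply, skip_zero, Fin.val_succ] <;> omega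

/-- Consequence: the steps of the first coordinate are `0` or `1`. [folklore] -/
theorem fst_succ_le_of_mem_support_shuffle {n p : ℕ} {w : Fin (n + 1) → V} (hw : w ∈ (shuffle n p).support)
    (j : Fin n) : (w j.castSucc).1 ≤ (w j.succ).1 ∧ (w j.succ).1 ≤ (w j.castSucc).1 + 1 := by
  obtain ⟨-, hs⟩ := isPath_of_mem_support_shuffle hw
  rcases hs j with h | h <;> rw [h] <;> simp

/-- Consequence: the steps of the second coordinate are `0` or `1`, complementary to the first. [folklore] -/
theorem snd_succ_eq_of_mem_support_shuffle {n p : ℕ} {w : Fin (n + 1) → V} (hw : w ∈ (shuffle n p).support)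
    (j : Fin n) : (w j.succ).1 + (w j.succ).2 = (w j.castSucc).1 + (w j.castSucc).2 + 1 := by
  obtain ⟨-, hs⟩ := isPath_of_mem_support_shuffle hw
  rcases hs j with h | h <;> rw [h] <;> simp <;> omega

/-- Consequence: `(w i).1 + (w i).2 = i` along a tuple of `shuffle n p`. [folklore] -/
theorem fst_add_snd_of_mem_support_shuffle {n p : ℕ} {w : Fin (n + 1) → V} (hw : w ∈ (shuffle n p).support)
    (i : Fin (n + 1)) : (w i).1 + (w i).2 = i := by
  obtain ⟨h0, -⟩ := isPath_of_mem_support_shuffle hw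
  refine Fin.induction (by simp [h0]) (fun j hj ↦ ?_) i
  rw [snd_succ_eq_of_mem_support_shuffle hw j, hj, Fin.val_succ, Fin.val_castSucc]

/-- **Uniqueness of the straight path**: a tuple of `shuffle n p` whose first coordinate is `i` at
every index `i ≤ p` is the straight path `R^p U^{n-p}`. [folklore] -/
theorem eq_stdPath_of_mem_support_shuffle : ∀ {n p : ℕ} {w : Fin (n + 1) → V}, w ∈ (shuffle n p).support →
    (∀ i : Fin (n + 1), (i : ℕ) ≤ p → (w i).1 = i) → w = stdPath n p
  | n, 0, w, hw, _ => by
    classical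
    rw [shuffle_zero_right] at hw
    have h := Finsupp.support_single_subset hw
    rwa [Finset.mem_singleton] at h
  | 0, p + 1, w, hw, _ => by simp at hw
  | n + 1, p + 1, w, hw, hfront => by
    classical
    rw [shuffle_succ_succ] at hw
    rcases Finset.mem_union.mp (Finsupp.support_add hw) with h | h
    · obtain ⟨v, hv, rfl⟩ := exists_of_mem_support_cone_push h
      rw [stdPath_succ_succ, eq_stdPath_of_mem_support_shuffle hv fun i hi ↦ ?_]
      have := hfront i.succ (by simpa using hi)
      simpa using this
    · obtain ⟨v, hv, rfl⟩ := exists_of_mem_support_cone_push (Finsupp.support_smul h)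
      exfalso
      have h1 := hfront 1 (by simp)
      obtain ⟨hv0, -⟩ := isPath_of_mem_support_shuffle hv
      have : (Fin.cons o (faceU 0 ∘ v) : Fin (n + 2) → V) 1 = faceU 0 (v 0) := by
        rw [← Fin.succ_zero_eq_one, Fin.cons_succ, Function.comp_apply]
      rw [this, hv0] at h1
      simp at h1

/-- **The straight path has coefficient `+1`** in `shuffle n p` (`p ≤ n`): it is the shuffle with no
inversions. [folklore] -/
theorem shuffle_apply_stdPath : ∀ {n p : ℕ}, p ≤ n → shuffle n p (stdPath n p) = 1
  | n, 0, _ => by rw [shuffle_zero_right, Finsupp.single_eq_same]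
  | 0, p + 1, h => by omega
  | n + 1, p + 1, h => by
    classical
    rw [shuffle_succ_succ, Finsupp.add_apply, Finsupp.smul_apply]
    have h2 : (cone o (push (faceU 0) n (shuffle n (p + 1)))) (stdPath (n + 1) (p + 1)) = 0 := by
      rw [← Finsupp.notMem_support_iff]
      intro hmem
      obtain ⟨v, hv, hw⟩ := exists_of_mem_support_cone_push hmem
      have h1 := congrFun hw 1
      obtain ⟨hv0, -⟩ := isPath_of_mem_support_shuffle hv
      have : (Fin.cons o (faceU 0 ∘ v) : Fin (n + 2) → V) 1 = faceU 0 (v 0) := by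
        rw [← Fin.succ_zero_eq_one, Fin.cons_succ, Function.comp_apply]
      rw [this, hv0, stdPath_apply_of_le (by simp)] at h1
      simp at h1
    have h1 : (cone o (push (faceR 0) n (shuffle n p))) (stdPath (n + 1) (p + 1)) = 1 := by
      have hinj : Function.Injective
          ((fun v : Fin (n + 1) → V ↦ (Fin.cons o v : Fin (n + 2) → V)) ∘ fun w ↦ faceR 0 ∘ w) := by
        intro v v' hvv'
        funext i
        have := congrFun hvv' i.succ
        simp only [Function.comp_apply, Fin.cons_succ, faceR_apply, skip_zero, Prod.mk.injEq] at this
        exact Prod.ext (by omega) this.2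
      rw [stdPath_succ_succ]
      change Finsupp.mapDomain _ (Finsupp.mapDomain _ (shuffle n p)) _ = 1
      rw [← Finsupp.mapDomain_comp]
      exact (Finsupp.mapDomain_apply hinj (shuffle n p) (stdPath n p)).trans (shuffle_apply_stdPath (by omega))
    rw [h1, h2, smul_zero, add_zero]

/-! ### The Alexander–Whitney ∘ Eilenberg–Zilber diagonal and its homotopy to the diagonal -/

/-- The diagonal coface map `δᵢ × δᵢ` of the lattice. [folklore] -/
def dface (i : ℕ) : V → V := Prod.map (skip i) (skip i)

/-- Components of `δᵢ × δᵢ`. [folklore] -/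
@[simp] theorem dface_apply (i : ℕ) (v : V) : dface i v = (skip i v.1, skip i v.2) := rfl

/-- The vertical translation `(a, b) ↦ (a, b + p)` placing a `(p,q)`-shuffle over the back face. [folklore] -/
def emb (p : ℕ) : V → V := fun v ↦ (v.1, v.2 + p)

/-- Components of `emb p`. [folklore] -/
@[simp] theorem emb_apply (p : ℕ) (v : V) : emb p v = (v.1, v.2 + p) := rfl

/-- `emb (p+1) ∘ Rᵢ = (δᵢ × δᵢ) ∘ emb p` for `i ≤ p`. [folklore] -/
theorem emb_succ_comp_faceR {i p : ℕ} (h : i ≤ p) : emb (p + 1) ∘ faceR i = dface i ∘ emb p := by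
  funext v
  simp only [Function.comp_apply, emb_apply, faceR_apply, dface_apply, Prod.mk.injEq, true_and]
  rw [skip_of_le (by omega)]
  ring

/-- `emb p ∘ U₀ = emb (p+1)`. [folklore] -/
theorem emb_comp_faceU_zero (p : ℕ) : emb p ∘ faceU 0 = emb (p + 1) := by
  funext v
  simp only [Function.comp_apply, emb_apply, faceU_apply, skip_zero, Prod.mk.injEq, true_and]
  ring

/-- On chains in the box `[0,p] × [0,q]`: `emb p ∘ U_{j+1} = (δ_{p+1+j} × δ_{p+1+j}) ∘ emb p`. [folklore] -/
theorem push_emb_faceU_succ {n p q j : ℕ} {x : TupleChain V n} (hx : VertsIn (box p q) x) :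
    push (emb p ∘ faceU (j + 1)) n x = push (dface (p + 1 + j) ∘ emb p) n x := by
  refine push_congr hx fun v hv ↦ ?_
  obtain ⟨h1, -⟩ := hv
  simp only [Function.comp_apply, emb_apply, faceU_apply, dface_apply, Prod.mk.injEq]
  refine ⟨(skip_of_lt (by omega)).symm, ?_⟩
  simp only [skip]
  split_ifs <;> omega

/-- On chains in the box `[0,p] × [0,q]` the face `R_{p+1}` acts trivially. [folklore] -/
theorem push_faceR_succ_of_vertsIn {n p q : ℕ} {x : TupleChain V n} (hx : VertsIn (box p q) x) :
    push (faceR (p + 1)) n x = x := by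
  rw [push_congr (g := fun v ↦ v) hx fun v hv ↦ ?_, push_id_apply]
  obtain ⟨h1, -⟩ := hv
  simp only [faceR_apply, skip_of_lt (Nat.lt_succ_of_le h1)]

/-- **The Alexander–Whitney / Eilenberg–Zilber diagonal chain** `θ_m = ∑_{p+q=m} emb p (shuffle m p)`:
the universal form of `σ ↦ ∑_{p+q=m} (front_p σ) × (back_q σ)` (Eilenberg–Zilber shuffle product of the
Alexander–Whitney diagonal; Hatcher (2002), §3.B with §3.2). [cite: HatcherAT2002, §3.B pp. 277–278] -/
def theta (m : ℕ) : TupleChain V m :=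
  ∑ x ∈ Finset.antidiagonal m, push (emb x.1) m (shuffle m x.1)

/-- The diagonal-face boundary operator `∑_{i < r} (-1)ⁱ (δᵢ × δᵢ)` (`r` faces). [folklore] -/
def dsum (n r : ℕ) (x : TupleChain V n) : TupleChain V n :=
  ∑ i ∈ range r, ((-1 : ℤ) ^ i) • push (dface i) n x

/-- Unfolding `dsum`. [folklore] -/
theorem dsum_apply (n r : ℕ) (x : TupleChain V n) :
    dsum n r x = ∑ i ∈ range r, ((-1 : ℤ) ^ i) • push (dface i) n x := rfl

/-- `dsum` is additive. [folklore] -/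
@[simp] theorem dsum_add (n r : ℕ) (x y : TupleChain V n) : dsum n r (x + y) = dsum n r x + dsum n r y := by
  simp [dsum, Finset.sum_add_distrib]
/-- `dsum` commutes with integer scalars. [folklore] -/
@[simp] theorem dsum_zsmul (n r : ℕ) (c : ℤ) (x : TupleChain V n) : dsum n r (c • x) = c • dsum n r x := by
  simp [dsum, Finset.smul_sum, smul_comm c]
/-- `dsum 0 = 0`. [folklore] -/
@[simp] theorem dsum_zero (n r : ℕ) : dsum n r (0 : TupleChain V n) = 0 := by simp [dsum]
/-- `dsum` commutes with negation. [folklore] -/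
@[simp] theorem dsum_neg (n r : ℕ) (x : TupleChain V n) : dsum n r (-x) = -dsum n r x := by
  simpa using dsum_zsmul n r (-1) x
/-- `dsum` commutes with subtraction. [folklore] -/
@[simp] theorem dsum_sub (n r : ℕ) (x y : TupleChain V n) : dsum n r (x - y) = dsum n r x - dsum n r y := by
  simp [sub_eq_add_neg]
/-- `dsum` commutes with finite sums. [folklore] -/
theorem dsum_sum (n r : ℕ) {ι : Type*} (t : Finset ι) (f : ι → TupleChain V n) :
    dsum n r (∑ i ∈ t, f i) = ∑ i ∈ t, dsum n r (f i) := by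
  simp [dsum, map_sum, Finset.smul_sum, Finset.sum_comm (s := range r)]

/-- `dsum` commutes with the boundary. [folklore] -/
theorem bd_dsum (n r : ℕ) (x : TupleChain V (n + 1)) : bd n (dsum (n + 1) r x) = dsum n r (bd n x) := by
  simp [dsum, map_sum, push_bd]

/-- The per-`(p,q)` identity behind `∂ θ`: the Leibniz-type recombination of the horizontal boundary
of the `(p+1, q)`-shuffles and the vertical boundary of the `(p, q+1)`-shuffles into diagonal faces. [folklore] -/
theorem theta_step (p q : ℕ) :
    push (emb (p + 1)) (p + q) (bdR (p + q) (p + 1) (shuffle (p + q) p)) +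
        ((-1 : ℤ) ^ p) • push (emb p) (p + q) (bdU (p + q) (q + 1) (shuffle (p + q) p)) =
      ∑ i ∈ range (p + 1 + (q + 1)), ((-1 : ℤ) ^ i) • push (dface i ∘ emb p) (p + q) (shuffle (p + q) p) := by
  have hx : VertsIn (box p q) (shuffle (p + q) p) := by
    simpa using vertsIn_shuffle (p + q) p
  rw [Finset.sum_range_add, bdR_apply, Finset.sum_range_succ, map_add, map_sum, push_faceR_succ_of_vertsIn hx,
    bdU_apply, Finset.sum_range_succ' _ (q + 1), map_add, map_sum]
  simp only [map_zsmul, push_push, pow_zero, one_smul, emb_comp_faceU_zero]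
  have h1 : ∀ i ∈ range (p + 1), ((-1 : ℤ) ^ i) • push (emb (p + 1) ∘ faceR i) (p + q) (shuffle (p + q) p) =
      ((-1 : ℤ) ^ i) • push (dface i ∘ emb p) (p + q) (shuffle (p + q) p) := fun i hi ↦ by
    rw [emb_succ_comp_faceR (Nat.lt_succ_iff.mp (Finset.mem_range.mp hi))]
  have h2 : ∀ j ∈ range (q + 1), ((-1 : ℤ) ^ (j + 1)) • push (emb p ∘ faceU (j + 1)) (p + q) (shuffle (p + q) p) =
      -(((-1 : ℤ) ^ j) • push (dface (p + 1 + j) ∘ emb p) (p + q) (shuffle (p + q) p)) := fun j _ ↦ by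
    rw [push_emb_faceU_succ hx, pow_succ, mul_neg_one, neg_smul]
  rw [Finset.sum_congr rfl h1, Finset.sum_congr rfl h2, Finset.sum_neg_distrib, smul_add, smul_neg, Finset.smul_sum]
  simp only [smul_smul, ← pow_add]
  have h3 : ∀ j ∈ range (q + 1), ((-1 : ℤ) ^ (p + j)) • push (dface (p + 1 + j) ∘ emb p) (p + q) (shuffle (p + q) p) =
      -(((-1 : ℤ) ^ (p + 1 + j)) • push (dface (p + 1 + j) ∘ emb p) (p + q) (shuffle (p + q) p)) := fun j _ ↦ by
    rw [show p + 1 + j = (p + j) + 1 by ring, pow_succ, mul_neg_one, neg_smul, neg_neg]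
  rw [Finset.sum_congr rfl h3, Finset.sum_neg_distrib, pow_succ, mul_neg_one, neg_smul]
  abel

/-- **`θ` is a chain map in the universal sense**: `∂ θ_{m+1} = ∑_{i ≤ m+1} (-1)ⁱ (δᵢ × δᵢ) θ_m`
(realized: `∂ Θ(σ) = Θ(∂σ)`), from the Eilenberg–Zilber boundary formula and the Alexander–Whitney
telescoping. [cite: HatcherAT2002, §3.B pp. 277–278] -/
theorem bd_theta (m : ℕ) : bd m (theta (m + 1)) = dsum m (m + 2) (theta m) := by
  rw [theta, map_sum]
  have h : ∀ x ∈ Finset.antidiagonal (m + 1), bd m (push (emb x.1) (m + 1) (shuffle (m + 1) x.1)) =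
      push (emb x.1) m (bdR m x.1 (shuffleR m x.1)) +
        ((-1 : ℤ) ^ x.1) • push (emb x.1) m (bdU m x.2 (shuffle m x.1)) := fun x hx ↦ by
    rw [← push_bd, bd_shuffle (Finset.mem_antidiagonal.mp hx), map_add, map_zsmul]
  rw [Finset.sum_congr rfl h, Finset.sum_add_distrib, Finset.Nat.sum_antidiagonal_succ]
  rw [Finset.Nat.sum_antidiagonal_succ' (f := fun x ↦ ((-1 : ℤ) ^ x.1) • push (emb x.1) m (bdU m x.2 (shuffle m x.1)))]
  simp only [shuffleR_zero, bdR_zero, map_zero, zero_add, shuffleR_succ, shuffle_eq_zero_of_lt (Nat.lt_succ_self m),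
    bdU_zero, smul_zero, ← Finset.sum_add_distrib]
  rw [theta, dsum_sum]
  refine Finset.sum_congr rfl fun x hx ↦ ?_
  obtain ⟨p, q⟩ := x
  have hpq : p + q = m := Finset.mem_antidiagonal.mp hx
  subst hpq
  rw [dsum_apply, show p + q + 2 = p + 1 + (q + 1) by ring]
  simp only [push_push]
  exact theta_step p q

/-- The diagonal tuple `[(0,0), (1,1), …, (m,m)]`. [folklore] -/
def diag (m : ℕ) : TupleChain V m := Finsupp.single (fun k : Fin (m + 1) ↦ ((k : ℕ), (k : ℕ))) 1

/-- **Faces of the diagonal**: `∂ diag_{m+1} = ∑_{i ≤ m+1} (-1)ⁱ (δᵢ × δᵢ) diag_m`. [folklore] -/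
theorem bd_diag (m : ℕ) : bd m (diag (m + 1)) = dsum m (m + 2) (diag m) := by
  rw [diag, bd_single, dsum_apply, diag]
  rw [← Fin.sum_univ_eq_sum_range (fun i ↦ ((-1 : ℤ) ^ i) • push (dface i) m (Finsupp.single (fun k : Fin (m + 1) ↦ ((k : ℕ), (k : ℕ))) 1)) (m + 2)]
  refine Finset.sum_congr rfl fun i _ ↦ ?_
  rw [push_single]
  congr 2
  funext k
  simp only [Function.comp_apply, dface_apply, val_succAbove]

/-- `θ₀ = diag₀ = [(0,0)]`. [folklore] -/
theorem theta_zero : theta 0 = diag 0 := by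
  rw [theta, Finset.Nat.antidiagonal_zero, Finset.sum_singleton, shuffle_zero_zero, push_single, diag]
  congr 1
  funext k
  simp [Fin.fin_one_eq_zero k]

/-- **The double face sum vanishes**: `∑_{i<r+2} ∑_{j<r+1} (-1)ⁱ⁺ʲ (δᵢ × δᵢ)(δⱼ × δⱼ) x = 0` (the
cosimplicial identities `δⱼ₊₁ δᵢ = δᵢ δⱼ`, `i ≤ j`; the universal form of `∂∂σ = 0`). [folklore] -/
theorem dsum_dsum (n r : ℕ) (x : TupleChain V n) : dsum n (r + 2) (dsum n (r + 1) x) = 0 := by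
  rw [dsum_apply]
  simp only [dsum_apply, map_sum, map_zsmul, Finset.smul_sum, smul_smul, push_push, ← pow_add]
  rw [Finset.sum_sigma' (range (r + 2)) (fun _ ↦ range (r + 1))
    (fun i j ↦ ((-1 : ℤ) ^ (i + j)) • push (dface i ∘ dface j) n x)]
  refine Finset.sum_involution (fun a _ ↦ if a.1 ≤ a.2 then ⟨a.2 + 1, a.1⟩ else ⟨a.2, a.1 - 1⟩) ?_ ?_ ?_ ?_
  · rintro ⟨i, j⟩ ha
    obtain ⟨hi, hj⟩ : i < r + 2 ∧ j < r + 1 := by simpa using ha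
    dsimp only
    split_ifs with h
    · dsimp only
      have hc : dface (j + 1) ∘ dface i = dface i ∘ dface j := by
        funext v
        simp only [Function.comp_apply, dface_apply, Prod.mk.injEq]
        exact ⟨congrFun (skip_succ_comp_skip h) v.1, congrFun (skip_succ_comp_skip h) v.2⟩
      rw [hc, show j + 1 + i = (i + j) + 1 by ring, pow_succ, mul_neg_one, neg_smul, add_neg_cancel]
    · dsimp only
      obtain ⟨i', rfl⟩ : ∃ i', i = i' + 1 := ⟨i - 1, by omega⟩
      have h' : j ≤ i' := by omega
      have hc : dface (i' + 1) ∘ dface j = dface j ∘ dface i' := by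
        funext v
        simp only [Function.comp_apply, dface_apply, Prod.mk.injEq]
        exact ⟨congrFun (skip_succ_comp_skip h') v.1, congrFun (skip_succ_comp_skip h') v.2⟩
      rw [hc, Nat.add_sub_cancel, show i' + 1 + j = (j + i') + 1 by ring, pow_succ, mul_neg_one, neg_smul,
        neg_add_cancel]
  · rintro ⟨i, j⟩ _ _
    dsimp only
    by_cases h : i ≤ j
    · rw [if_pos h]
      simp only [ne_eq, Sigma.mk.injEq, heq_eq_eq, not_and]
      omega
    · rw [if_neg h]
      simp only [ne_eq, Sigma.mk.injEq, heq_eq_eq, not_and]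
      omega
  · rintro ⟨i, j⟩ ha
    obtain ⟨hi, hj⟩ : i < r + 2 ∧ j < r + 1 := by simpa using ha
    dsimp only
    by_cases h : i ≤ j
    · rw [if_pos h]
      simp only [Finset.mem_sigma, Finset.mem_range]
      omega
    · rw [if_neg h]
      simp only [Finset.mem_sigma, Finset.mem_range]
      omega
  · rintro ⟨i, j⟩ _
    dsimp only
    by_cases h : i ≤ j
    · rw [if_pos h]
      dsimp only
      rw [if_neg (by omega)]
      simp
    · rw [if_neg h]
      dsimp only
      rw [if_pos (by omega)]
      ext
      · simp only; omega
      · rfl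

/-- **The universal Eilenberg–Zilber homotopy chains** `D_m ∈ TupleChain (ℕ × ℕ) (m+1)` between the
diagonal `diag_m` and the AW∘EZ diagonal chain `θ_m`, by the cone recursion (constructive acyclic
models: the cone with apex `o` contracts the tuple complex, Eilenberg–Mac Lane 1953):
`D₀ = 0`, `D_{m+1} = o · (diag_{m+1} - θ_{m+1} - ∑_{i ≤ m+1} (-1)ⁱ (δᵢ × δᵢ) D_m)`. [folklore] -/
def homotopyChain : (m : ℕ) → TupleChain V (m + 1)
  | 0 => 0
  | m + 1 => cone o (diag (m + 1) - theta (m + 1) - dsum (m + 1) (m + 2) (homotopyChain m))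

/-- `D₀ = 0`. [folklore] -/
@[simp] theorem homotopyChain_zero : homotopyChain 0 = 0 := rfl
/-- The cone recursion for `D_{m+1}`. [folklore] -/
theorem homotopyChain_succ (m : ℕ) : homotopyChain (m + 1) =
    cone o (diag (m + 1) - theta (m + 1) - dsum (m + 1) (m + 2) (homotopyChain m)) := rfl

/-- **The homotopy formula** `∂ D_{m+1} + ∑_{i ≤ m+1} (-1)ⁱ (δᵢ × δᵢ) D_m = diag_{m+1} - θ_{m+1}`
(realized: `∂D + D∂ = Δ_* - Θ`; Eilenberg–Zilber / acyclic models). [cite: HatcherAT2002, §3.B pp. 277–278] -/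
theorem bd_homotopyChain : ∀ m : ℕ, bd (m + 1) (homotopyChain (m + 1)) =
    diag (m + 1) - theta (m + 1) - dsum (m + 1) (m + 2) (homotopyChain m)
  | 0 => by
    have hz : bd 0 (diag 1 - theta 1 - dsum 1 2 (homotopyChain 0)) = 0 := by
      rw [map_sub, map_sub, bd_diag, bd_theta, homotopyChain_zero, dsum_zero, map_zero, theta_zero]
      abel
    rw [homotopyChain_succ, bd_cone_succ, hz, map_zero, sub_zero]
  | m + 1 => by
    have hz : bd (m + 1) (diag (m + 2) - theta (m + 2) - dsum (m + 2) (m + 3) (homotopyChain (m + 1))) = 0 := by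
      rw [map_sub, map_sub, bd_diag, bd_theta, bd_dsum, bd_homotopyChain m, dsum_sub, dsum_sub, dsum_dsum]
      abel
    rw [homotopyChain_succ (m + 1), bd_cone_succ, hz, map_zero, sub_zero]

end ShuffleChains

end Literature.AlgebraicTopology.SingularHomology
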